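import Literature.Computability.AlgebraicComplexity.ValiantClasses
import HarnessLib

/-!
# Noncrossing perfect matchings of an interval: the first-arc decomposition (support for
`FifoMatching.NCInVP`, step 2)

Combinatorial core: for the noncrossing fixed-point-free involutions `M` of an interval `[i,j)`
(extended by the identity outside), the partner `a = M i` splits `M` into a noncrossing matching
of `(i,a)` and one of `(a,j)`, bijectively, with weight
`wt M = x_{i,a} · wt M|_(i,a) · wt M|_(a,j)` (`wt M = ∏_{x < M x} x_{x, M x}`). [folklore]
-/

noncomputable section

-- layout Summits/ValiantsHypothesis/ValiantsHypothesis forces the duplicated namespace component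
set_option linter.dupNamespace false

namespace Summit.ValiantsHypothesis.ValiantsHypothesis.Theorems.FifoMatching

open MvPolynomial

universe u

variable {k : Type u} [CommSemiring k] {N : ℕ}

/-- `M` is a noncrossing perfect matching of the interval `[i,j)` (as a fixed-point-free involution
there), extended by the identity outside. [folklore] -/
def IsNCOn (i j : ℕ) (M : Fin N → Fin N) : Prop :=
  (∀ x : Fin N, ((x : ℕ) < i ∨ j ≤ (x : ℕ)) → M x = x) ∧
  (∀ x : Fin N, i ≤ (x : ℕ) → (x : ℕ) < j →
    i ≤ (M x : ℕ) ∧ (M x : ℕ) < j ∧ M (M x) = x ∧ M x ≠ x) ∧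
  (∀ p q : Fin N, p < q → q < M p → M p < M q → False)

/-- The weight `∏_{x < M x} x_{x, M x}` of a matching. [folklore] -/
def wt (k : Type u) [CommSemiring k] (M : Fin N → Fin N) : MvPolynomial (Fin N × Fin N) k :=
  ∏ x : Fin N, if x < M x then X (x, M x) else 1

/-- Restriction of a matching to the window `[lo, hi)` (identity outside). [folklore] -/
def restrict (lo hi : ℕ) (M : Fin N → Fin N) : Fin N → Fin N :=
  fun x => if lo ≤ (x : ℕ) ∧ (x : ℕ) < hi then M x else x

/-- Gluing: the arc `(i, a)` together with a matching `M₁` of `(i,a)` and a matching `M₂` of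
`(a, j)`. [folklore] -/
def glue (i a : Fin N) (M₁ M₂ : Fin N → Fin N) : Fin N → Fin N :=
  fun x => if x = i then a else if x = a then i else if (x : ℕ) < a then M₁ x else M₂ x

/-! ### The partner of the left endpoint and the two restrictions -/

section Split

variable {i j : ℕ} {M : Fin N → Fin N}

/-- The partner `a = M i` of the left endpoint lies in `(i, j)`. [folklore] -/
theorem partner_mem (hM : IsNCOn i j M) (hij : i < j) (hi : i < N) :
    i < (M ⟨i, hi⟩ : ℕ) ∧ (M ⟨i, hi⟩ : ℕ) < j := by
  obtain ⟨h1, h2, h3, h4⟩ := hM.2.1 ⟨i, hi⟩ le_rfl hij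
  refine ⟨lt_of_le_of_ne h1 fun h => h4 (Fin.ext h.symm), h2⟩

/-- Points strictly inside the first arc are matched strictly inside it (noncrossing). [folklore] -/
theorem inner_mem (hM : IsNCOn i j M) (hij : i < j) (hi : i < N) (x : Fin N)
    (hx1 : i < (x : ℕ)) (hx2 : (x : ℕ) < (M ⟨i, hi⟩ : ℕ)) :
    i < (M x : ℕ) ∧ (M x : ℕ) < (M ⟨i, hi⟩ : ℕ) := by
  obtain ⟨ha1, ha2⟩ := partner_mem hM hij hi
  obtain ⟨h1, h2, h3, h4⟩ := hM.2.1 x hx1.le (lt_trans hx2 ha2)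
  obtain ⟨-, -, hii, -⟩ := hM.2.1 ⟨i, hi⟩ le_rfl hij
  refine ⟨lt_of_le_of_ne h1 fun h => ?_, ?_⟩
  · -- `M x = i` would force `x = M i`
    have hMx : M x = ⟨i, hi⟩ := Fin.ext h.symm
    have : x = M ⟨i, hi⟩ := by rw [← hMx, h3]
    exact lt_irrefl _ (this ▸ hx2)
  · rcases lt_trichotomy (M x : ℕ) (M ⟨i, hi⟩ : ℕ) with h | h | h
    · exact h
    · exfalso
      have hMx : M x = M ⟨i, hi⟩ := Fin.ext h
      have hxi : x = ⟨i, hi⟩ := by rw [← h3, hMx, hii]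
      have := congrArg Fin.val hxi
      simp at this; omega
    · exact (hM.2.2 ⟨i, hi⟩ x hx1 hx2 h).elim

/-- Points beyond the first arc are matched beyond it. [folklore] -/
theorem outer_mem (hM : IsNCOn i j M) (hij : i < j) (hi : i < N) (x : Fin N)
    (hx1 : (M ⟨i, hi⟩ : ℕ) < (x : ℕ)) (hx2 : (x : ℕ) < j) :
    (M ⟨i, hi⟩ : ℕ) < (M x : ℕ) ∧ (M x : ℕ) < j := by
  obtain ⟨ha1, ha2⟩ := partner_mem hM hij hi
  obtain ⟨h1, h2, h3, h4⟩ := hM.2.1 x (by omega) hx2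
  obtain ⟨-, -, hii, -⟩ := hM.2.1 ⟨i, hi⟩ le_rfl hij
  refine ⟨?_, h2⟩
  rcases lt_trichotomy (M ⟨i, hi⟩ : ℕ) (M x : ℕ) with h | h | h
  · exact h
  · exfalso
    have hMx : M x = M ⟨i, hi⟩ := Fin.ext h.symm
    have : x = ⟨i, hi⟩ := by rw [← h3, hMx, hii]
    have := congrArg Fin.val this
    simp at this; omega
  · exfalso
    -- `M x` lies in `[i, a)`: it is `i` (impossible) or inside the arc, whose partner is inside
    rcases eq_or_lt_of_le h1 with h5 | h5
    · have hMx : M x = ⟨i, hi⟩ := Fin.ext h5.symm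
      have : x = M ⟨i, hi⟩ := by rw [← hMx, h3]
      exact lt_irrefl _ (this ▸ hx1)
    · have := (inner_mem hM hij hi (M x) h5 h).2
      rw [h3] at this
      omega

/-- The restriction to the inside of the first arc is a noncrossing matching of `(i, a)`. [folklore] -/
theorem isNCOn_restrict_inner (hM : IsNCOn i j M) (hij : i < j) (hi : i < N) :
    IsNCOn (i + 1) (M ⟨i, hi⟩ : ℕ) (restrict (i + 1) (M ⟨i, hi⟩ : ℕ) M) := by
  refine ⟨fun x hx => ?_, fun x hx1 hx2 => ?_, fun p q hpq hq hp => ?_⟩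
  · simp only [restrict]
    rw [if_neg]; omega
  · have hin := inner_mem hM hij hi x hx1 hx2
    obtain ⟨-, -, h3, h4⟩ := hM.2.1 x (by omega) (lt_trans hx2 (partner_mem hM hij hi).2)
    have hx : restrict (i + 1) (M ⟨i, hi⟩ : ℕ) M x = M x := by
      simp only [restrict]; rw [if_pos ⟨hx1, hx2⟩]
    rw [hx]
    refine ⟨hin.1, hin.2, ?_, h4⟩
    simp only [restrict]; rw [if_pos ⟨by omega, hin.2⟩, h3]
  · -- a crossing of the restriction is a crossing of `M`
    simp only [restrict] at hq hp
    split_ifs at hq hp with h1 h2 h2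
    · exact hM.2.2 p q hpq hq hp
    · exact absurd (lt_trans hq hp) (lt_irrefl q)
    · exact absurd (lt_trans hpq hq) (lt_irrefl p)
    · exact absurd (lt_trans hpq hq) (lt_irrefl p)

/-- The restriction to the outside of the first arc is a noncrossing matching of `(a, j)`. [folklore] -/
theorem isNCOn_restrict_outer (hM : IsNCOn i j M) (hij : i < j) (hi : i < N) :
    IsNCOn ((M ⟨i, hi⟩ : ℕ) + 1) j (restrict ((M ⟨i, hi⟩ : ℕ) + 1) j M) := by
  refine ⟨fun x hx => ?_, fun x hx1 hx2 => ?_, fun p q hpq hq hp => ?_⟩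
  · simp only [restrict]
    rw [if_neg]; omega
  · have hout := outer_mem hM hij hi x hx1 hx2
    obtain ⟨-, -, h3, h4⟩ := hM.2.1 x (by have := (partner_mem hM hij hi).1; omega) hx2
    have hx : restrict ((M ⟨i, hi⟩ : ℕ) + 1) j M x = M x := by
      simp only [restrict]; rw [if_pos ⟨hx1, hx2⟩]
    rw [hx]
    refine ⟨hout.1, hout.2, ?_, h4⟩
    simp only [restrict]; rw [if_pos ⟨by omega, hout.2⟩, h3]
  · simp only [restrict] at hq hp
    split_ifs at hq hp
    · exact hM.2.2 p q hpq hq hp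
    · exact absurd (lt_trans hq hp) (lt_irrefl q)
    · exact absurd (lt_trans hpq hq) (lt_irrefl p)
    · exact absurd (lt_trans hpq hq) (lt_irrefl p)

/-- **Weight factorisation along the first arc**: `wt M = x_{i,a} · wt M|_(i,a) · wt M|_(a,j)`.
[folklore] -/
theorem wt_eq_mul (hM : IsNCOn i j M) (hij : i < j) (hi : i < N) :
    wt k M = X (⟨i, hi⟩, M ⟨i, hi⟩) * wt k (restrict (i + 1) (M ⟨i, hi⟩ : ℕ) M) *
      wt k (restrict ((M ⟨i, hi⟩ : ℕ) + 1) j M) := by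
  classical
  obtain ⟨ha1, ha2⟩ := partner_mem hM hij hi
  obtain ⟨-, -, hii, -⟩ := hM.2.1 ⟨i, hi⟩ le_rfl hij
  -- pointwise factorisation of the factors of the product
  have key : ∀ x : Fin N, (if x < M x then X (x, M x) else (1 : MvPolynomial (Fin N × Fin N) k)) =
      (if x = ⟨i, hi⟩ then X (⟨i, hi⟩, M ⟨i, hi⟩) else 1) *
      (if x < restrict (i + 1) (M ⟨i, hi⟩ : ℕ) M x then
          X (x, restrict (i + 1) (M ⟨i, hi⟩ : ℕ) M x) else 1) *
      (if x < restrict ((M ⟨i, hi⟩ : ℕ) + 1) j M x then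
          X (x, restrict ((M ⟨i, hi⟩ : ℕ) + 1) j M x) else 1) := by
    intro x
    by_cases hxi : x = ⟨i, hi⟩
    · subst hxi
      have hlt : (⟨i, hi⟩ : Fin N) < M ⟨i, hi⟩ := Fin.lt_def.mpr ha1
      simp only [restrict, hlt, if_true, show ¬ (i + 1 ≤ i ∧ i < (M ⟨i, hi⟩ : ℕ)) by omega,
        show ¬ ((M ⟨i, hi⟩ : ℕ) + 1 ≤ i ∧ i < j) by omega, if_false, lt_self_iff_false, mul_one]
    · rw [if_neg hxi, one_mul]
      by_cases hin : i + 1 ≤ (x : ℕ) ∧ (x : ℕ) < (M ⟨i, hi⟩ : ℕ)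
      · -- inside the arc: only the inner restriction contributes
        have h1 : restrict (i + 1) (M ⟨i, hi⟩ : ℕ) M x = M x := by
          simp only [restrict]; rw [if_pos hin]
        have h2 : restrict ((M ⟨i, hi⟩ : ℕ) + 1) j M x = x := by
          simp only [restrict]; rw [if_neg (by omega)]
        rw [h1, h2]; simp
      · by_cases hout : (M ⟨i, hi⟩ : ℕ) + 1 ≤ (x : ℕ) ∧ (x : ℕ) < j
        · have h1 : restrict (i + 1) (M ⟨i, hi⟩ : ℕ) M x = x := by
            simp only [restrict]; rw [if_neg hin]
          have h2 : restrict ((M ⟨i, hi⟩ : ℕ) + 1) j M x = M x := by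
            simp only [restrict]; rw [if_pos hout]
          rw [h1, h2]; simp
        · -- `x = a` or `x` outside `[i, j)`: all three factors are `1`
          have h1 : restrict (i + 1) (M ⟨i, hi⟩ : ℕ) M x = x := by
            simp only [restrict]; rw [if_neg hin]
          have h2 : restrict ((M ⟨i, hi⟩ : ℕ) + 1) j M x = x := by
            simp only [restrict]; rw [if_neg hout]
          rw [h1, h2]
          have hx : ¬ x < M x := by
            by_cases hxa : (x : ℕ) = (M ⟨i, hi⟩ : ℕ)
            · have : x = M ⟨i, hi⟩ := Fin.ext hxa
              rw [this, hii]
              exact fun h => absurd (lt_trans (Fin.lt_def.mpr ha1) h) (lt_irrefl _)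
            · have hfix : M x = x := hM.1 x (by
                have : (x : ℕ) ≠ i := fun h => hxi (Fin.ext h)
                omega)
              rw [hfix]; exact lt_irrefl _
          simp [hx]
  unfold wt
  rw [Finset.prod_congr rfl fun x _ => key x, Finset.prod_mul_distrib, Finset.prod_mul_distrib,
    Finset.prod_ite_eq']
  simp

/-! ### Gluing -/

variable {a : ℕ} {M₁ M₂ : Fin N → Fin N}

/-- Values of the glued map. [folklore] -/
theorem glue_apply_left (hi : i < N) (ha : a < N) :
    glue ⟨i, hi⟩ ⟨a, ha⟩ M₁ M₂ ⟨i, hi⟩ = ⟨a, ha⟩ := by simp [glue]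

/-- Values of the glued map. [folklore] -/
theorem glue_apply_right (hi : i < N) (ha : a < N) (hia : i < a) :
    glue ⟨i, hi⟩ ⟨a, ha⟩ M₁ M₂ ⟨a, ha⟩ = ⟨i, hi⟩ := by
  have : (⟨a, ha⟩ : Fin N) ≠ ⟨i, hi⟩ := fun h => by have := congrArg Fin.val h; simp at this; omega
  simp [glue, this]

/-- Values of the glued map. [folklore] -/
theorem glue_apply_of_lt (hi : i < N) (ha : a < N) (x : Fin N) (hx1 : (x : ℕ) ≠ i) (hx2 : (x : ℕ) < a) :
    glue ⟨i, hi⟩ ⟨a, ha⟩ M₁ M₂ x = M₁ x := by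
  have h1 : x ≠ ⟨i, hi⟩ := fun h => hx1 (by rw [h])
  have h2 : x ≠ ⟨a, ha⟩ := fun h => by rw [h] at hx2; exact lt_irrefl _ hx2
  simp [glue, h1, h2, hx2]

/-- Values of the glued map. [folklore] -/
theorem glue_apply_of_gt (hi : i < N) (ha : a < N) (hia : i < a) (x : Fin N) (hx : a < (x : ℕ)) :
    glue ⟨i, hi⟩ ⟨a, ha⟩ M₁ M₂ x = M₂ x := by
  have h1 : x ≠ ⟨i, hi⟩ := fun h => by rw [h] at hx; simp at hx; omega
  have h2 : x ≠ ⟨a, ha⟩ := fun h => by rw [h] at hx; exact lt_irrefl _ hx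
  have h3 : ¬ (x : ℕ) < a := by omega
  simp [glue, h1, h2, h3]

/-- **Gluing two noncrossing matchings along a new outer arc gives a noncrossing matching.**
[folklore] -/
theorem isNCOn_glue (hia : i < a) (haj : a < j) (hjN : j ≤ N)
    (h₁ : IsNCOn (i + 1) a M₁) (h₂ : IsNCOn (a + 1) j M₂) :
    IsNCOn i j (glue ⟨i, by omega⟩ ⟨a, by omega⟩ M₁ M₂) := by
  have hi : i < N := by omega
  have ha : a < N := by omega
  -- the glued map by region
  have gi := glue_apply_left (M₁ := M₁) (M₂ := M₂) hi ha
  have ga := glue_apply_right (M₁ := M₁) (M₂ := M₂) hi ha hia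
  have gin := fun (x : Fin N) (h1 : (x : ℕ) ≠ i) (h2 : (x : ℕ) < a) =>
    glue_apply_of_lt (M₁ := M₁) (M₂ := M₂) hi ha x h1 h2
  have gout := fun (x : Fin N) (h : a < (x : ℕ)) =>
    glue_apply_of_gt (M₁ := M₁) (M₂ := M₂) hi ha hia x h
  refine ⟨fun x hx => ?_, fun x hx1 hx2 => ?_, fun p q hpq hq hp => ?_⟩
  · -- identity outside `[i, j)`
    rcases hx with hx | hx
    · rw [gin x (by omega) (by omega)]; exact h₁.1 x (Or.inl (by omega))
    · rw [gout x (by omega)]; exact h₂.1 x (Or.inr hx)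
  · -- matching on `[i, j)`
    by_cases hxi : (x : ℕ) = i
    · have hx : x = ⟨i, hi⟩ := Fin.ext hxi
      subst hx
      rw [gi, ga]
      refine ⟨by simp; omega, by simpa using haj, rfl, fun h => ?_⟩
      have := congrArg Fin.val h; simp at this; omega
    by_cases hxa : (x : ℕ) = a
    · have hx : x = ⟨a, ha⟩ := Fin.ext hxa
      subst hx
      rw [ga, gi]
      refine ⟨by simp, by simp; omega, rfl, fun h => ?_⟩
      have := congrArg Fin.val h; simp at this; omega
    by_cases hlt : (x : ℕ) < a
    · obtain ⟨m1, m2, m3, m4⟩ := h₁.2.1 x (by omega) hlt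
      rw [gin x hxi hlt, gin (M₁ x) (by omega) m2, m3]
      exact ⟨by omega, by omega, rfl, m4⟩
    · have hgt : a < (x : ℕ) := by omega
      obtain ⟨m1, m2, m3, m4⟩ := h₂.2.1 x (by omega) hx2
      rw [gout x hgt, gout (M₂ x) (by omega), m3]
      exact ⟨by omega, m2, rfl, m4⟩
  · -- noncrossing
    have hpq' : (p : ℕ) < (q : ℕ) := hpq
    by_cases hp1 : (p : ℕ) < i
    · rw [gin p (by omega) (by omega), h₁.1 p (Or.inl (by omega))] at hq
      exact absurd (lt_trans hpq hq) (lt_irrefl _)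
    by_cases hp2 : (p : ℕ) = i
    · have hp' : p = ⟨i, hi⟩ := Fin.ext hp2
      subst hp'
      rw [gi] at hq hp
      have hq' : (q : ℕ) < a := hq
      rw [gin q (by simp at hpq'; omega) hq'] at hp
      have := (h₁.2.1 q (by simp at hpq'; omega) hq').2.1
      have hp'' : a < (M₁ q : ℕ) := hp
      omega
    by_cases hp3 : (p : ℕ) < a
    · obtain ⟨m1, m2, -, -⟩ := h₁.2.1 p (by omega) hp3
      rw [gin p hp2 hp3] at hq hp
      have hq' : (q : ℕ) < (M₁ p : ℕ) := hq
      rw [gin q (by omega) (by omega)] at hp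
      exact h₁.2.2 p q hpq hq hp
    by_cases hp4 : (p : ℕ) = a
    · have hp' : p = ⟨a, ha⟩ := Fin.ext hp4
      subst hp'
      rw [ga] at hq
      have : (q : ℕ) < i := hq
      simp at hpq'; omega
    by_cases hp5 : (p : ℕ) < j
    · have hgt : a < (p : ℕ) := by omega
      obtain ⟨m1, m2, -, -⟩ := h₂.2.1 p (by omega) hp5
      rw [gout p hgt] at hq hp
      have hq' : (q : ℕ) < (M₂ p : ℕ) := hq
      rw [gout q (by omega)] at hp
      exact h₂.2.2 p q hpq hq hp
    · rw [gout p (by omega), h₂.1 p (Or.inr (by omega))] at hq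
      exact absurd (lt_trans hpq hq) (lt_irrefl _)

/-- Restricting the glued map to the inside of the arc recovers `M₁`. [folklore] -/
theorem restrict_glue_inner (hia : i < a) (haN : a < N) (h₁ : IsNCOn (i + 1) a M₁) :
    restrict (i + 1) a (glue ⟨i, by omega⟩ ⟨a, haN⟩ M₁ M₂) = M₁ := by
  funext x
  simp only [restrict]
  split_ifs with h
  · exact glue_apply_of_lt _ _ x (by omega) h.2
  · exact (h₁.1 x (by omega)).symm

/-- Restricting the glued map to the outside of the arc recovers `M₂`. [folklore] -/
theorem restrict_glue_outer (hia : i < a) (haj : a < j) (hjN : j ≤ N) (h₂ : IsNCOn (a + 1) j M₂) :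
    restrict (a + 1) j (glue ⟨i, by omega⟩ ⟨a, by omega⟩ M₁ M₂) = M₂ := by
  funext x
  simp only [restrict]
  split_ifs with h
  · exact glue_apply_of_gt _ _ hia x (by omega)
  · exact (h₂.1 x (by omega)).symm

/-- Gluing back the two restrictions recovers the matching. [folklore] -/
theorem glue_restrict (hM : IsNCOn i j M) (hij : i < j) (hi : i < N) :
    glue ⟨i, hi⟩ (M ⟨i, hi⟩) (restrict (i + 1) (M ⟨i, hi⟩ : ℕ) M)
      (restrict ((M ⟨i, hi⟩ : ℕ) + 1) j M) = M := by
  obtain ⟨ha1, ha2⟩ := partner_mem hM hij hi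
  obtain ⟨-, -, hii, -⟩ := hM.2.1 ⟨i, hi⟩ le_rfl hij
  have ha : (M ⟨i, hi⟩ : ℕ) < N := (M ⟨i, hi⟩).2
  funext x
  by_cases hxi : (x : ℕ) = i
  · have hx : x = ⟨i, hi⟩ := Fin.ext hxi
    subst hx
    exact glue_apply_left hi ha
  by_cases hxa : (x : ℕ) = (M ⟨i, hi⟩ : ℕ)
  · have hx : x = M ⟨i, hi⟩ := Fin.ext hxa
    rw [hx, show (M ⟨i, hi⟩) = ⟨(M ⟨i, hi⟩ : ℕ), ha⟩ from rfl, glue_apply_right hi ha ha1]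
    exact hii.symm
  by_cases hlt : (x : ℕ) < (M ⟨i, hi⟩ : ℕ)
  · rw [show (M ⟨i, hi⟩) = ⟨(M ⟨i, hi⟩ : ℕ), ha⟩ from rfl, glue_apply_of_lt hi ha x hxi hlt]
    simp only [restrict]
    split_ifs with h
    · rfl
    · exact (hM.1 x (Or.inl (by omega))).symm
  · rw [show (M ⟨i, hi⟩) = ⟨(M ⟨i, hi⟩ : ℕ), ha⟩ from rfl, glue_apply_of_gt hi ha ha1 x (by omega)]
    simp only [restrict]
    split_ifs with h
    · rfl
    · exact (hM.1 x (Or.inr (by omega))).symm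

end Split

end Summit.ValiantsHypothesis.ValiantsHypothesis.Theorems.FifoMatching

end
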